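import Summits.CriticalPhenomena.CardyFormulaZ2.Theorems.CardyFlipRussoQuadrupoleSelectionRuleGaussianDilation
import Summits.CriticalPhenomena.CardyFormulaZ2.Theorems.CardyFlipRussoQuadrupoleSelectionRuleCoordinateInfluence

/-!
# The annealed Russo INEQUALITY of the Gaussian-jitter leg

Helper file for the informal kernel crux `QuadrupoleSelectionRule` (stmt-CriticalPhenomena-7029) of
route `CardyFlipRusso` (sub-problem `CardyFormulaZ2`), line `Sketch`, generation 4 (lead c2).
Composition of the two landed stubs of this generation:

* R1 `hasDerivAt_integral_gaussian_dilate` — along the jitter leg `σ ↦ E[F(σξ)]`,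
  `ξ ∼ ⊗_{i∈ι} 𝒩(0,1)`, the derivative is `σ⁻¹ E[F(σξ)(Σᵢ ξᵢ² − n)]`;
* R2 `abs_integral_mul_coord_le` — a centred weight of ONE coordinate integrates against a bounded
  `G` to at most `‖G‖∞ ‖h‖₁ P[Nᵢ]`, `Nᵢ ⊇ {G depends on coordinate i}`.

Consequence (`abs_jitterDeriv_le_sum_influence`): the derivative is bounded by
`2 σ⁻¹ ‖F‖∞ Σᵢ P[Nᵢ]` — the sum over the jittered coordinates of the probabilities that the
coordinate is "geometrically pivotal" for `F` (for a crossing event: moving the site changes the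
crossing, which happens only through a chain of Delaunay flips at that site).  This is the
jitter-leg counterpart of the flip-leg Russo inequality `abs_flipDrift_le_fourArm_sum`: the
a-priori bound that the selection rule must beat by cancellation in the signed sum.
-/

noncomputable section

open MeasureTheory ProbabilityTheory Finset
open scoped BigOperators

namespace Summit.CriticalPhenomena.CardyFormulaZ2.Theorems

namespace JitterRusso

/-- `t ↦ t²` is integrable for the standard Gaussian. [folklore] -/
theorem integrable_sq : Integrable (fun t : ℝ => t ^ 2) (gaussianReal 0 1) := by
  simpa using (memLp_id_gaussianReal (μ := 0) (v := 1) 2).integrable_sq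

/-- `t ↦ t² − 1` is integrable for the standard Gaussian. [folklore] -/
theorem integrable_sq_sub_one : Integrable (fun t : ℝ => t ^ 2 - 1) (gaussianReal 0 1) :=
  integrable_sq.sub (integrable_const _)

/-- `t ↦ t² − 1` is centred for the standard Gaussian (its second moment is `1`; the bare
second-moment identity is `Literature.Computability.QuantumComplexity.integral_sq_gaussianReal_zero_one`,
re-derived inline here from the variance to keep the imports light). [folklore] -/
theorem integral_sq_sub_one : ∫ t, (t ^ 2 - 1) ∂(gaussianReal 0 1) = 0 := by
  have hv : Var[fun x ↦ x; gaussianReal 0 1] = ((1 : NNReal) : ℝ) := variance_fun_id_gaussianReal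
  rw [variance_eq_integral aemeasurable_id'] at hv
  have hm : (gaussianReal 0 1)[fun x : ℝ ↦ x] = 0 := integral_id_gaussianReal
  have h2 : ∫ t, t ^ 2 ∂(gaussianReal 0 1) = 1 := by simpa [hm] using hv
  rw [integral_sub integrable_sq (integrable_const _), h2]
  simp

/-- `‖t² − 1‖₁ ≤ 2` for the standard Gaussian. [folklore] -/
theorem integral_abs_sq_sub_one_le : ∫ t, |t ^ 2 - 1| ∂(gaussianReal 0 1) ≤ 2 := by
  have h1 : ∀ t : ℝ, |t ^ 2 - 1| ≤ t ^ 2 + 1 := fun t => by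
    rw [abs_le]; constructor <;> nlinarith [sq_nonneg t]
  have hi : Integrable (fun t : ℝ => t ^ 2 + 1) (gaussianReal 0 1) :=
    integrable_sq.add (integrable_const _)
  calc ∫ t, |t ^ 2 - 1| ∂(gaussianReal 0 1) ≤ ∫ t, (t ^ 2 + 1) ∂(gaussianReal 0 1) :=
        integral_mono integrable_sq_sub_one.abs hi h1
    _ = 2 := by
        have h2 : ∫ t, t ^ 2 ∂(gaussianReal 0 1) = 1 := by
          have h0 := integral_sq_sub_one
          rw [integral_sub integrable_sq (integrable_const _)] at h0
          simpa [sub_eq_zero] using h0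
        rw [integral_add integrable_sq (integrable_const _), h2]
        simp; norm_num

/-- The coordinate weight `x ↦ (x i)² − 1` is integrable under the product Gaussian. [folklore] -/
theorem integrable_sq_eval_sub_one {ι : Type*} [Fintype ι] (i : ι) :
    Integrable (fun x : ι → ℝ => x i ^ 2 - 1) (Measure.pi fun _ : ι => gaussianReal 0 1) :=
  (measurePreserving_eval (fun _ : ι => gaussianReal 0 1) i).integrable_comp
    integrable_sq_sub_one.aestronglyMeasurable |>.2 integrable_sq_sub_one

end JitterRusso

open JitterRusso

/-- **Annealed Russo inequality of the jitter leg.**  For a bounded measurable `F` of finitely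
many i.i.d. standard Gaussian coordinates, `σ > 0`, and measurable sets `N i` not depending on
coordinate `i` off which `x ↦ F(σ x)` does not depend on coordinate `i`:
`|σ⁻¹ E[F(σξ)(Σᵢ ξᵢ² − n)]| ≤ σ⁻¹ · 2‖F‖∞ · Σᵢ P[N i]` — by R1 the left-hand side is
`|d/dσ E[F(σξ)]|`. [folklore] -/
theorem abs_jitterDeriv_le_sum_influence :
    ∀ (ι : Type*) [Fintype ι] [DecidableEq ι] (F : (ι → ℝ) → ℝ), Measurable F → ∀ C : ℝ,
      (∀ x, |F x| ≤ C) → ∀ σ : ℝ, 0 < σ → ∀ N : ι → Set (ι → ℝ), (∀ i, MeasurableSet (N i)) →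
        (∀ (i : ι) (x : ι → ℝ) (t : ℝ), x ∈ N i ↔ Function.update x i t ∈ N i) →
          (∀ i, ∀ x ∉ N i, ∀ t : ℝ, F (σ • Function.update x i t) = F (σ • x)) →
            |σ⁻¹ * ∫ x, F (σ • x) * (∑ i, x i ^ 2 - (Fintype.card ι : ℝ))
                ∂(MeasureTheory.Measure.pi fun _ : ι => ProbabilityTheory.gaussianReal 0 1)| ≤
              σ⁻¹ * (2 * C) *
                ∑ i, (MeasureTheory.Measure.pi fun _ : ι => ProbabilityTheory.gaussianReal 0 1).real
                  (N i) := by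
  intro ι _ _ F hF C hC σ hσ N hN hNi hdep
  set γ : Measure (ι → ℝ) := Measure.pi fun _ : ι => gaussianReal 0 1 with hγ
  set G : (ι → ℝ) → ℝ := fun x => F (σ • x) with hG
  have hGm : Measurable G := hF.comp (measurable_const_smul σ)
  have hGb : ∀ x, |G x| ≤ C := fun x => hC _
  have hC0 : 0 ≤ C := le_trans (abs_nonneg _) (hC 0)
  -- each coordinate term is integrable
  have hint : ∀ i, Integrable (fun x => G x * (x i ^ 2 - 1)) γ := fun i =>
    (integrable_sq_eval_sub_one i).bdd_mul hGm.aestronglyMeasurable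
      (Filter.Eventually.of_forall fun x => by simpa [Real.norm_eq_abs] using hGb x)
  -- the weight is the sum of the coordinate weights
  have hsum : ∀ x : ι → ℝ, G x * (∑ i, x i ^ 2 - (Fintype.card ι : ℝ)) =
      ∑ i, G x * (x i ^ 2 - 1) := fun x => by
    rw [← Finset.mul_sum, Finset.sum_sub_distrib]
    simp
  have hI : ∫ x, G x * (∑ i, x i ^ 2 - (Fintype.card ι : ℝ)) ∂γ =
      ∑ i, ∫ x, G x * (x i ^ 2 - 1) ∂γ := by
    rw [integral_congr_ae (Filter.Eventually.of_forall hsum)]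
    exact integral_finsetSum _ fun i _ => hint i
  -- R2 on each coordinate
  have hR2 : ∀ i, |∫ x, G x * (x i ^ 2 - 1) ∂γ| ≤ C * 2 * γ.real (N i) := by
    intro i
    have h := abs_integral_mul_coord_le ι (fun _ : ι => gaussianReal 0 1) i G hGm C hGb
      (fun t => t ^ 2 - 1) integrable_sq_sub_one integral_sq_sub_one (N i) (hN i) (hNi i)
      (fun x hx t => hdep i x hx t)
    refine h.trans ?_
    have hN0 : 0 ≤ γ.real (N i) := measureReal_nonneg
    exact mul_le_mul_of_nonneg_right (mul_le_mul_of_nonneg_left integral_abs_sq_sub_one_le hC0)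
      hN0
  -- combine
  rw [abs_mul, abs_of_pos (inv_pos.2 hσ), mul_assoc]
  refine mul_le_mul_of_nonneg_left ?_ (inv_pos.2 hσ).le
  rw [hI, Finset.mul_sum]
  refine (Finset.abs_sum_le_sum_abs _ _).trans (Finset.sum_le_sum fun i _ => ?_)
  have := hR2 i
  linarith

end Summit.CriticalPhenomena.CardyFormulaZ2.Theorems

end
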